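import Summits.BirchSwinnertonDyer.Rank1Residual.LW16.DescentReRouteShape
import Literature.NumberTheory.EllipticCurves.ShaIsogenyDescentPairingProofs
import HarnessLib

/-!
# LW16 re-route kernel, SECOND-DESCENT display: `BSD(E,p)` per pair from a `p`-isogeny descent
# `Ш(E)[φ] = 0` and a Cassels–Tate NON-DEGENERACY certificate on `Ш(Ê)[φ̂]` (derived `hSha`)

HONEST FRAMING (cell `pub/bsd-litref/lw16`, seat `bsd-litref-lw16-ty` g5; programme BSD-LIT2PART v1 §T3/§T4,
RESISO lane): nothing here proves BSD; per pair, never a class theorem; NOTHING is booked by this file (the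
desk books). This is the DERIVED-DISPLAY variant (referee A2 pricing wake bc7791e3, ask (γ)(b)) of the
class-free Ш-currency kernel `bsdp_of_ainvs_of_noPTorsionSha` (this directory, p458836): instead of READING
the certificate line `hSha : Ш(E/ℚ)[p] = 0`, the record READS what a second-descent instrument actually
outputs — a rational `p`-isogeny `φ : E → Ê` with dual `ψ` (`ψ ∘ φ = [p]`), `Ш(φ)` injective (first
descent: `Ш(E)[φ] = 0`), and the Cassels–Tate pairing on `Ш(Ê)` NON-DEGENERATE on `Ш(Ê)[ψ] = ker Ш(ψ)`
(adjoint to the pairing on `Ш(E)`: Milne *ADT* I Rem. 6.10(a)) — and DERIVES `hSha` in the tree by the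
sorry-free Literature theorem `sha_nsmul_torsion_eq_zero_of_shaMap_injective_of_pairing_nondegenerate`
(p528798; the easy half of Fisher, *J. Number Theory* 98 (2003) Thm. 3; van Beek–Fisher, *Acta Arith.*
185 (2018) §1). Two forms: (A) the pairings `B`, `B′` are binders (any abelian value group) with the
adjointness displayed; (B) the pairings are SUPPLIED by the PUBLISHED named fact
`exists_casselsTate_pairing_adjoint ℚ` (Cassels 1962/1965, Milne I.6.9/6.10/6.13) and the certificate is
phrased over EVERY adjoint pair of alternating pairings with divisible kernels (the sceptic's form, as in
`X1.CasselsTateIsogenyCertificate.bsdp_of_casselsTate_adjoint_certificate`); (C) PAIRING-FREE: the second-descent datum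
displayed as `Ш(Ê)[ψ] ∩ Ш(φ)(Ш(E)) = 0` — what non-degeneracy MEANS on `Ш` by Fisher 2003 Thm. 3 — via
`sha_nsmul_torsion_eq_zero_of_shaMap_injective_of_ker_inter_range` (p531153); given `Ш(φ)` injective this binder is
EQUIVALENT to `Ш(E)[p] = 0` (`sha_nsmul_torsion_eq_zero_iff_ker_inter_range`). The isogeny is a BINDER
(`WeierstrassCurve.Isogeny`), not constructed here. Ellipticity of the literal model is kernel-decided
(`discOf ≠ 0`). Theorems only (no definition, no named fact, no `sorry`).

References: [Fisher2003] Thm. 3 (p. 123); [vanBeekFisher2018] §1 p. 369; [MilneADT2006] I Prop. 6.9,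
Rem. 6.10(a), Thm. 6.13(a); [Miller2011LMS] §1, Def. 1.1; [MillerStoll2013] §§6–7, Thm. 9.1.
-/

set_option autoImplicit false

noncomputable section

open scoped Classical

open WeierstrassCurve Literature.NumberTheory.EllipticCurves
  Literature.NumberTheory.EllipticCurves.Rank1Residual.Typed
  Literature.NumberTheory.EllipticCurves.Rank1Residual.X11RankOneCertificates
  Summit.BirchSwinnertonDyer.Rank1Residual.X11b

universe w

namespace Summit.BirchSwinnertonDyer.Rank1Residual.LW16

/-- **Record shape (second-descent display, form A), analytic rank `≤ 1`.** On the literal model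
`[a₁,a₂,a₃,a₄,a₆]` (`Δ ≠ 0` kernel-decided), `BSD(E,p)` from: GZK (`hGZK`), `r_an ≤ 1` (`hr`), `#Ш_an = q`
with `ord_p q = 0` (`hq`, `hv`), a dual pair of isogenies `φ : E → Ê`, `ψ : Ê → E` with `ψ ∘ φ = [p]`
(`hψφ`), bi-additive pairings `B`, `B′` on `Ш(E)`, `Ш(Ê)` making `Ш(φ)`, `Ш(ψ)` adjoint (`hadj`), the
first-descent datum `Ш(φ)` injective (`hinj`) and the second-descent datum `B′` non-degenerate on
`ker Ш(ψ) = Ш(Ê)[ψ]` (`hND`). The composition is `bsdp_of_ainvs_of_noPTorsionSha` fed with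
`sha_nsmul_torsion_eq_zero_of_shaMap_injective_of_pairing_nondegenerate`.
[cite: Fisher2003, Thm. 3] [cite: MilneADT2006, Ch. I Remark 6.10(a)] [cite: Miller2011LMS, §1 and Def. 1.1] -/
theorem bsdp_of_ainvs_of_shaMap_injective_of_pairing_nondegenerate
    (hGZK : rank_eq_analyticRank_of_analyticRank_le_one)
    (a1 a2 a3 a4 a6 : ℤ) (p : ℕ) [Fact p.Prime] (hΔ : discOf [a1, a2, a3, a4, a6] ≠ 0)
    (hr : (⟨a1, a2, a3, a4, a6⟩ : WeierstrassCurve ℚ).analyticRank ≤ 1) {q : ℚ}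
    (hq : shaAn (⟨a1, a2, a3, a4, a6⟩ : WeierstrassCurve ℚ) = (q : ℂ)) (hv : padicValRat p q = 0)
    (W' : WeierstrassCurve ℚ) (φ : Isogeny (⟨a1, a2, a3, a4, a6⟩ : WeierstrassCurve ℚ) W')
    (ψ : Isogeny W' (⟨a1, a2, a3, a4, a6⟩ : WeierstrassCurve ℚ))
    (hψφ : ∀ P : (⟨a1, a2, a3, a4, a6⟩ : WeierstrassCurve ℚ).geomPoints, ψ (φ P) = (p : ℤ) • P)
    {C : Type w} [AddCommGroup C]
    (B : (⟨a1, a2, a3, a4, a6⟩ : WeierstrassCurve ℚ).sha →+ (⟨a1, a2, a3, a4, a6⟩ : WeierstrassCurve ℚ).sha →+ C)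
    (B' : W'.sha →+ W'.sha →+ C)
    (hadj : ∀ a b,
      B' (shaMap φ.toAddMonoidHom φ.equivariant φ.hasLocalPointsMaps_toAddMonoidHom a) b =
        B a (shaMap ψ.toAddMonoidHom ψ.equivariant ψ.hasLocalPointsMaps_toAddMonoidHom b))
    (hinj : ∀ a, shaMap φ.toAddMonoidHom φ.equivariant φ.hasLocalPointsMaps_toAddMonoidHom a = 0 → a = 0)
    (hND : ∀ y, shaMap ψ.toAddMonoidHom ψ.equivariant ψ.hasLocalPointsMaps_toAddMonoidHom y = 0 →
      (∀ z, shaMap ψ.toAddMonoidHom ψ.equivariant ψ.hasLocalPointsMaps_toAddMonoidHom z = 0 → B' y z = 0) →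
        y = 0) :
    BSDp (⟨a1, a2, a3, a4, a6⟩ : WeierstrassCurve ℚ) p :=
  bsdp_of_ainvs_of_noPTorsionSha hGZK a1 a2 a3 a4 a6 p hΔ hr hq hv
    (sha_nsmul_torsion_eq_zero_of_shaMap_injective_of_pairing_nondegenerate φ ψ hψφ B B' hadj hinj hND)

/-- **Form A, analytic rank `0` displayed.** [cite: Fisher2003, Thm. 3] [cite: Miller2011LMS, §1 and Def. 1.1] -/
theorem bsdp_rankZero_of_ainvs_of_shaMap_injective_of_pairing_nondegenerate
    (hGZK : rank_eq_analyticRank_of_analyticRank_le_one)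
    (a1 a2 a3 a4 a6 : ℤ) (p : ℕ) [Fact p.Prime] (hΔ : discOf [a1, a2, a3, a4, a6] ≠ 0)
    (hr : (⟨a1, a2, a3, a4, a6⟩ : WeierstrassCurve ℚ).analyticRank = 0) {q : ℚ}
    (hq : shaAn (⟨a1, a2, a3, a4, a6⟩ : WeierstrassCurve ℚ) = (q : ℂ)) (hv : padicValRat p q = 0)
    (W' : WeierstrassCurve ℚ) (φ : Isogeny (⟨a1, a2, a3, a4, a6⟩ : WeierstrassCurve ℚ) W')
    (ψ : Isogeny W' (⟨a1, a2, a3, a4, a6⟩ : WeierstrassCurve ℚ))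
    (hψφ : ∀ P : (⟨a1, a2, a3, a4, a6⟩ : WeierstrassCurve ℚ).geomPoints, ψ (φ P) = (p : ℤ) • P)
    {C : Type w} [AddCommGroup C]
    (B : (⟨a1, a2, a3, a4, a6⟩ : WeierstrassCurve ℚ).sha →+ (⟨a1, a2, a3, a4, a6⟩ : WeierstrassCurve ℚ).sha →+ C)
    (B' : W'.sha →+ W'.sha →+ C)
    (hadj : ∀ a b,
      B' (shaMap φ.toAddMonoidHom φ.equivariant φ.hasLocalPointsMaps_toAddMonoidHom a) b =
        B a (shaMap ψ.toAddMonoidHom ψ.equivariant ψ.hasLocalPointsMaps_toAddMonoidHom b))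
    (hinj : ∀ a, shaMap φ.toAddMonoidHom φ.equivariant φ.hasLocalPointsMaps_toAddMonoidHom a = 0 → a = 0)
    (hND : ∀ y, shaMap ψ.toAddMonoidHom ψ.equivariant ψ.hasLocalPointsMaps_toAddMonoidHom y = 0 →
      (∀ z, shaMap ψ.toAddMonoidHom ψ.equivariant ψ.hasLocalPointsMaps_toAddMonoidHom z = 0 → B' y z = 0) →
        y = 0) :
    BSDp (⟨a1, a2, a3, a4, a6⟩ : WeierstrassCurve ℚ) p :=
  bsdp_of_ainvs_of_shaMap_injective_of_pairing_nondegenerate hGZK a1 a2 a3 a4 a6 p hΔ (by omega) hq hv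
    W' φ ψ hψφ B B' hadj hinj hND

/-- **Form A, analytic rank `1` displayed.** [cite: Fisher2003, Thm. 3] [cite: Miller2011LMS, §1 and Def. 1.1] -/
theorem bsdp_rankOne_of_ainvs_of_shaMap_injective_of_pairing_nondegenerate
    (hGZK : rank_eq_analyticRank_of_analyticRank_le_one)
    (a1 a2 a3 a4 a6 : ℤ) (p : ℕ) [Fact p.Prime] (hΔ : discOf [a1, a2, a3, a4, a6] ≠ 0)
    (hr : (⟨a1, a2, a3, a4, a6⟩ : WeierstrassCurve ℚ).analyticRank = 1) {q : ℚ}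
    (hq : shaAn (⟨a1, a2, a3, a4, a6⟩ : WeierstrassCurve ℚ) = (q : ℂ)) (hv : padicValRat p q = 0)
    (W' : WeierstrassCurve ℚ) (φ : Isogeny (⟨a1, a2, a3, a4, a6⟩ : WeierstrassCurve ℚ) W')
    (ψ : Isogeny W' (⟨a1, a2, a3, a4, a6⟩ : WeierstrassCurve ℚ))
    (hψφ : ∀ P : (⟨a1, a2, a3, a4, a6⟩ : WeierstrassCurve ℚ).geomPoints, ψ (φ P) = (p : ℤ) • P)
    {C : Type w} [AddCommGroup C]
    (B : (⟨a1, a2, a3, a4, a6⟩ : WeierstrassCurve ℚ).sha →+ (⟨a1, a2, a3, a4, a6⟩ : WeierstrassCurve ℚ).sha →+ C)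
    (B' : W'.sha →+ W'.sha →+ C)
    (hadj : ∀ a b,
      B' (shaMap φ.toAddMonoidHom φ.equivariant φ.hasLocalPointsMaps_toAddMonoidHom a) b =
        B a (shaMap ψ.toAddMonoidHom ψ.equivariant ψ.hasLocalPointsMaps_toAddMonoidHom b))
    (hinj : ∀ a, shaMap φ.toAddMonoidHom φ.equivariant φ.hasLocalPointsMaps_toAddMonoidHom a = 0 → a = 0)
    (hND : ∀ y, shaMap ψ.toAddMonoidHom ψ.equivariant ψ.hasLocalPointsMaps_toAddMonoidHom y = 0 →
      (∀ z, shaMap ψ.toAddMonoidHom ψ.equivariant ψ.hasLocalPointsMaps_toAddMonoidHom z = 0 → B' y z = 0) →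
        y = 0) :
    BSDp (⟨a1, a2, a3, a4, a6⟩ : WeierstrassCurve ℚ) p :=
  bsdp_of_ainvs_of_shaMap_injective_of_pairing_nondegenerate hGZK a1 a2 a3 a4 a6 p hΔ (by omega) hq hv
    W' φ ψ hψφ B B' hadj hinj hND

/-- **Record shape (second-descent display, form B: the pairings SUPPLIED by the named fact**
`exists_casselsTate_pairing_adjoint ℚ`; Cassels 1962/1965, Milne *ADT* I Prop. 6.9, Rem. 6.10(a), Thm.
6.13(a)). Binders: GZK, the PUBLISHED fact `hCT`, the literal model (`Δ ≠ 0` kernel-decided), `r_an ≤ 1`,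
`#Ш_an = q` with `ord_p q = 0`, an elliptic `Ê` (`W'`), a dual pair `φ`, `ψ` with `ψ ∘ φ = [deg φ]`,
`deg φ = p`, `Ш(φ)` injective, and the certificate: for EVERY pair of alternating pairings `B`, `B′` with
divisible kernels making `Ш(φ)`, `Ш(ψ)` adjoint (the fact's shape), `B′` is non-degenerate on `Ш(Ê)[ψ]`.
[cite: MilneADT2006, Ch. I Prop. 6.9, Remark 6.10(a), Thm. 6.13(a)] [cite: Fisher2003, Thm. 3]
[cite: Miller2011LMS, §1 and Def. 1.1] -/
theorem bsdp_of_ainvs_of_casselsTate_adjoint_certificate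
    (hGZK : rank_eq_analyticRank_of_analyticRank_le_one) (hCT : exists_casselsTate_pairing_adjoint ℚ)
    (a1 a2 a3 a4 a6 : ℤ) (p : ℕ) [Fact p.Prime] (hΔ : discOf [a1, a2, a3, a4, a6] ≠ 0)
    (hr : (⟨a1, a2, a3, a4, a6⟩ : WeierstrassCurve ℚ).analyticRank ≤ 1) {q : ℚ}
    (hq : shaAn (⟨a1, a2, a3, a4, a6⟩ : WeierstrassCurve ℚ) = (q : ℂ)) (hv : padicValRat p q = 0)
    (W' : WeierstrassCurve ℚ) [W'.IsElliptic] (φ : Isogeny (⟨a1, a2, a3, a4, a6⟩ : WeierstrassCurve ℚ) W')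
    (ψ : Isogeny W' (⟨a1, a2, a3, a4, a6⟩ : WeierstrassCurve ℚ))
    (hψφ : ∀ P : (⟨a1, a2, a3, a4, a6⟩ : WeierstrassCurve ℚ).geomPoints, ψ (φ P) = (φ.degree : ℤ) • P)
    (hdeg : φ.degree = p)
    (hinj : ∀ a, shaMap φ.toAddMonoidHom φ.equivariant φ.hasLocalPointsMaps_toAddMonoidHom a = 0 → a = 0)
    (hcert : ∀ (B : (⟨a1, a2, a3, a4, a6⟩ : WeierstrassCurve ℚ).sha →+
        (⟨a1, a2, a3, a4, a6⟩ : WeierstrassCurve ℚ).sha →+ AddCircle (1 : ℚ))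
        (B' : W'.sha →+ W'.sha →+ AddCircle (1 : ℚ)),
      (∀ x, B x x = 0) →
      (∀ x, (∀ y, B x y = 0) ↔ x ∈ AddSubgroup.divisibleElements (⟨a1, a2, a3, a4, a6⟩ : WeierstrassCurve ℚ).sha) →
      (∀ x, B' x x = 0) → (∀ x, (∀ y, B' x y = 0) ↔ x ∈ AddSubgroup.divisibleElements W'.sha) →
      (∀ a b, B' (shaMap φ.toAddMonoidHom φ.equivariant φ.hasLocalPointsMaps_toAddMonoidHom a) b =
        B a (shaMap ψ.toAddMonoidHom ψ.equivariant ψ.hasLocalPointsMaps_toAddMonoidHom b)) →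
      ∀ y : W'.sha, shaMap ψ.toAddMonoidHom ψ.equivariant ψ.hasLocalPointsMaps_toAddMonoidHom y = 0 →
        (∀ z : W'.sha, shaMap ψ.toAddMonoidHom ψ.equivariant ψ.hasLocalPointsMaps_toAddMonoidHom z = 0 →
          B' y z = 0) → y = 0) :
    BSDp (⟨a1, a2, a3, a4, a6⟩ : WeierstrassCurve ℚ) p := by
  haveI := isElliptic_of_discOf_ne_zero a1 a2 a3 a4 a6 hΔ
  obtain ⟨B, B', hBalt, hBker, hB'alt, hB'ker, hadj⟩ := hCT _ W' φ ψ hψφ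
  have hψφ' : ∀ P : (⟨a1, a2, a3, a4, a6⟩ : WeierstrassCurve ℚ).geomPoints, ψ (φ P) = (p : ℤ) • P := by
    intro P; rw [hψφ P, hdeg]
  exact bsdp_of_ainvs_of_shaMap_injective_of_pairing_nondegenerate hGZK a1 a2 a3 a4 a6 p hΔ hr hq hv
    W' φ ψ hψφ' B B' hadj hinj (hcert B B' hBalt hBker hB'alt hB'ker hadj)


/-- **Form B, analytic rank `0` displayed.** [cite: MilneADT2006, Ch. I Remark 6.10(a)] [cite: Fisher2003, Thm. 3]
[cite: Miller2011LMS, §1 and Def. 1.1] -/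
theorem bsdp_rankZero_of_ainvs_of_casselsTate_adjoint_certificate
    (hGZK : rank_eq_analyticRank_of_analyticRank_le_one) (hCT : exists_casselsTate_pairing_adjoint ℚ)
    (a1 a2 a3 a4 a6 : ℤ) (p : ℕ) [Fact p.Prime] (hΔ : discOf [a1, a2, a3, a4, a6] ≠ 0)
    (hr : (⟨a1, a2, a3, a4, a6⟩ : WeierstrassCurve ℚ).analyticRank = 0) {q : ℚ}
    (hq : shaAn (⟨a1, a2, a3, a4, a6⟩ : WeierstrassCurve ℚ) = (q : ℂ)) (hv : padicValRat p q = 0)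
    (W' : WeierstrassCurve ℚ) [W'.IsElliptic] (φ : Isogeny (⟨a1, a2, a3, a4, a6⟩ : WeierstrassCurve ℚ) W')
    (ψ : Isogeny W' (⟨a1, a2, a3, a4, a6⟩ : WeierstrassCurve ℚ))
    (hψφ : ∀ P : (⟨a1, a2, a3, a4, a6⟩ : WeierstrassCurve ℚ).geomPoints, ψ (φ P) = (φ.degree : ℤ) • P)
    (hdeg : φ.degree = p)
    (hinj : ∀ a, shaMap φ.toAddMonoidHom φ.equivariant φ.hasLocalPointsMaps_toAddMonoidHom a = 0 → a = 0)
    (hcert : ∀ (B : (⟨a1, a2, a3, a4, a6⟩ : WeierstrassCurve ℚ).sha →+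
        (⟨a1, a2, a3, a4, a6⟩ : WeierstrassCurve ℚ).sha →+ AddCircle (1 : ℚ))
        (B' : W'.sha →+ W'.sha →+ AddCircle (1 : ℚ)),
      (∀ x, B x x = 0) →
      (∀ x, (∀ y, B x y = 0) ↔ x ∈ AddSubgroup.divisibleElements (⟨a1, a2, a3, a4, a6⟩ : WeierstrassCurve ℚ).sha) →
      (∀ x, B' x x = 0) → (∀ x, (∀ y, B' x y = 0) ↔ x ∈ AddSubgroup.divisibleElements W'.sha) →
      (∀ a b, B' (shaMap φ.toAddMonoidHom φ.equivariant φ.hasLocalPointsMaps_toAddMonoidHom a) b =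
        B a (shaMap ψ.toAddMonoidHom ψ.equivariant ψ.hasLocalPointsMaps_toAddMonoidHom b)) →
      ∀ y : W'.sha, shaMap ψ.toAddMonoidHom ψ.equivariant ψ.hasLocalPointsMaps_toAddMonoidHom y = 0 →
        (∀ z : W'.sha, shaMap ψ.toAddMonoidHom ψ.equivariant ψ.hasLocalPointsMaps_toAddMonoidHom z = 0 →
          B' y z = 0) → y = 0) :
    BSDp (⟨a1, a2, a3, a4, a6⟩ : WeierstrassCurve ℚ) p :=
  bsdp_of_ainvs_of_casselsTate_adjoint_certificate hGZK hCT a1 a2 a3 a4 a6 p hΔ (by omega) hq hv W' φ ψ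
    hψφ hdeg hinj hcert

/-- **Form B, analytic rank `1` displayed.** [cite: MilneADT2006, Ch. I Remark 6.10(a)] [cite: Fisher2003, Thm. 3]
[cite: Miller2011LMS, §1 and Def. 1.1] -/
theorem bsdp_rankOne_of_ainvs_of_casselsTate_adjoint_certificate
    (hGZK : rank_eq_analyticRank_of_analyticRank_le_one) (hCT : exists_casselsTate_pairing_adjoint ℚ)
    (a1 a2 a3 a4 a6 : ℤ) (p : ℕ) [Fact p.Prime] (hΔ : discOf [a1, a2, a3, a4, a6] ≠ 0)
    (hr : (⟨a1, a2, a3, a4, a6⟩ : WeierstrassCurve ℚ).analyticRank = 1) {q : ℚ}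
    (hq : shaAn (⟨a1, a2, a3, a4, a6⟩ : WeierstrassCurve ℚ) = (q : ℂ)) (hv : padicValRat p q = 0)
    (W' : WeierstrassCurve ℚ) [W'.IsElliptic] (φ : Isogeny (⟨a1, a2, a3, a4, a6⟩ : WeierstrassCurve ℚ) W')
    (ψ : Isogeny W' (⟨a1, a2, a3, a4, a6⟩ : WeierstrassCurve ℚ))
    (hψφ : ∀ P : (⟨a1, a2, a3, a4, a6⟩ : WeierstrassCurve ℚ).geomPoints, ψ (φ P) = (φ.degree : ℤ) • P)
    (hdeg : φ.degree = p)
    (hinj : ∀ a, shaMap φ.toAddMonoidHom φ.equivariant φ.hasLocalPointsMaps_toAddMonoidHom a = 0 → a = 0)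
    (hcert : ∀ (B : (⟨a1, a2, a3, a4, a6⟩ : WeierstrassCurve ℚ).sha →+
        (⟨a1, a2, a3, a4, a6⟩ : WeierstrassCurve ℚ).sha →+ AddCircle (1 : ℚ))
        (B' : W'.sha →+ W'.sha →+ AddCircle (1 : ℚ)),
      (∀ x, B x x = 0) →
      (∀ x, (∀ y, B x y = 0) ↔ x ∈ AddSubgroup.divisibleElements (⟨a1, a2, a3, a4, a6⟩ : WeierstrassCurve ℚ).sha) →
      (∀ x, B' x x = 0) → (∀ x, (∀ y, B' x y = 0) ↔ x ∈ AddSubgroup.divisibleElements W'.sha) →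
      (∀ a b, B' (shaMap φ.toAddMonoidHom φ.equivariant φ.hasLocalPointsMaps_toAddMonoidHom a) b =
        B a (shaMap ψ.toAddMonoidHom ψ.equivariant ψ.hasLocalPointsMaps_toAddMonoidHom b)) →
      ∀ y : W'.sha, shaMap ψ.toAddMonoidHom ψ.equivariant ψ.hasLocalPointsMaps_toAddMonoidHom y = 0 →
        (∀ z : W'.sha, shaMap ψ.toAddMonoidHom ψ.equivariant ψ.hasLocalPointsMaps_toAddMonoidHom z = 0 →
          B' y z = 0) → y = 0) :
    BSDp (⟨a1, a2, a3, a4, a6⟩ : WeierstrassCurve ℚ) p :=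
  bsdp_of_ainvs_of_casselsTate_adjoint_certificate hGZK hCT a1 a2 a3 a4 a6 p hΔ (by omega) hq hv W' φ ψ
    hψφ hdeg hinj hcert


/-! ### Form C (pairing-free display): `Ш(φ)` injective and `Ш(Ê)[ψ] ∩ Ш(φ)(Ш(E)) = 0` -/

/-- **Record shape (second-descent display, form C: PAIRING-FREE), analytic rank `≤ 1`.** As form A, but
the second-descent datum is displayed as what non-degeneracy MEANS on `Ш` (Fisher 2003 Thm. 3: the kernel
of the Cassels–Tate pairing on `Ш(Ê)[φ̂]` is `Ш(Ê)[φ̂] ∩ φ Ш(E)`): every `Ш(φ) a` killed by `Ш(ψ)` is `0`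
(`hker`). Given `hinj`, this binder is EQUIVALENT to `Ш(E)[p] = 0`
(`sha_nsmul_torsion_eq_zero_iff_ker_inter_range`), and it is implied by the form-A pairing datum
(`shaMap_ker_inter_range_eq_zero_of_pairing_nondegenerate`); no pairing and no named fact is displayed.
[cite: Fisher2003, Thm. 3] [cite: Miller2011LMS, §1 and Def. 1.1] -/
theorem bsdp_of_ainvs_of_shaMap_injective_of_ker_inter_range
    (hGZK : rank_eq_analyticRank_of_analyticRank_le_one)
    (a1 a2 a3 a4 a6 : ℤ) (p : ℕ) [Fact p.Prime] (hΔ : discOf [a1, a2, a3, a4, a6] ≠ 0)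
    (hr : (⟨a1, a2, a3, a4, a6⟩ : WeierstrassCurve ℚ).analyticRank ≤ 1) {q : ℚ}
    (hq : shaAn (⟨a1, a2, a3, a4, a6⟩ : WeierstrassCurve ℚ) = (q : ℂ)) (hv : padicValRat p q = 0)
    (W' : WeierstrassCurve ℚ) (φ : Isogeny (⟨a1, a2, a3, a4, a6⟩ : WeierstrassCurve ℚ) W')
    (ψ : Isogeny W' (⟨a1, a2, a3, a4, a6⟩ : WeierstrassCurve ℚ))
    (hψφ : ∀ P : (⟨a1, a2, a3, a4, a6⟩ : WeierstrassCurve ℚ).geomPoints, ψ (φ P) = (p : ℤ) • P)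
    (hinj : ∀ a, shaMap φ.toAddMonoidHom φ.equivariant φ.hasLocalPointsMaps_toAddMonoidHom a = 0 → a = 0)
    (hker : ∀ a, shaMap ψ.toAddMonoidHom ψ.equivariant ψ.hasLocalPointsMaps_toAddMonoidHom
        (shaMap φ.toAddMonoidHom φ.equivariant φ.hasLocalPointsMaps_toAddMonoidHom a) = 0 →
      shaMap φ.toAddMonoidHom φ.equivariant φ.hasLocalPointsMaps_toAddMonoidHom a = 0) :
    BSDp (⟨a1, a2, a3, a4, a6⟩ : WeierstrassCurve ℚ) p :=
  bsdp_of_ainvs_of_noPTorsionSha hGZK a1 a2 a3 a4 a6 p hΔ hr hq hv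
    (sha_nsmul_torsion_eq_zero_of_shaMap_injective_of_ker_inter_range φ ψ hψφ hinj hker)

/-- **Form C, analytic rank `0` displayed.** [cite: Fisher2003, Thm. 3] [cite: Miller2011LMS, §1 and Def. 1.1] -/
theorem bsdp_rankZero_of_ainvs_of_shaMap_injective_of_ker_inter_range
    (hGZK : rank_eq_analyticRank_of_analyticRank_le_one)
    (a1 a2 a3 a4 a6 : ℤ) (p : ℕ) [Fact p.Prime] (hΔ : discOf [a1, a2, a3, a4, a6] ≠ 0)
    (hr : (⟨a1, a2, a3, a4, a6⟩ : WeierstrassCurve ℚ).analyticRank = 0) {q : ℚ}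
    (hq : shaAn (⟨a1, a2, a3, a4, a6⟩ : WeierstrassCurve ℚ) = (q : ℂ)) (hv : padicValRat p q = 0)
    (W' : WeierstrassCurve ℚ) (φ : Isogeny (⟨a1, a2, a3, a4, a6⟩ : WeierstrassCurve ℚ) W')
    (ψ : Isogeny W' (⟨a1, a2, a3, a4, a6⟩ : WeierstrassCurve ℚ))
    (hψφ : ∀ P : (⟨a1, a2, a3, a4, a6⟩ : WeierstrassCurve ℚ).geomPoints, ψ (φ P) = (p : ℤ) • P)
    (hinj : ∀ a, shaMap φ.toAddMonoidHom φ.equivariant φ.hasLocalPointsMaps_toAddMonoidHom a = 0 → a = 0)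
    (hker : ∀ a, shaMap ψ.toAddMonoidHom ψ.equivariant ψ.hasLocalPointsMaps_toAddMonoidHom
        (shaMap φ.toAddMonoidHom φ.equivariant φ.hasLocalPointsMaps_toAddMonoidHom a) = 0 →
      shaMap φ.toAddMonoidHom φ.equivariant φ.hasLocalPointsMaps_toAddMonoidHom a = 0) :
    BSDp (⟨a1, a2, a3, a4, a6⟩ : WeierstrassCurve ℚ) p :=
  bsdp_of_ainvs_of_shaMap_injective_of_ker_inter_range hGZK a1 a2 a3 a4 a6 p hΔ (by omega) hq hv
    W' φ ψ hψφ hinj hker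

/-- **Form C, analytic rank `1` displayed.** [cite: Fisher2003, Thm. 3] [cite: Miller2011LMS, §1 and Def. 1.1] -/
theorem bsdp_rankOne_of_ainvs_of_shaMap_injective_of_ker_inter_range
    (hGZK : rank_eq_analyticRank_of_analyticRank_le_one)
    (a1 a2 a3 a4 a6 : ℤ) (p : ℕ) [Fact p.Prime] (hΔ : discOf [a1, a2, a3, a4, a6] ≠ 0)
    (hr : (⟨a1, a2, a3, a4, a6⟩ : WeierstrassCurve ℚ).analyticRank = 1) {q : ℚ}
    (hq : shaAn (⟨a1, a2, a3, a4, a6⟩ : WeierstrassCurve ℚ) = (q : ℂ)) (hv : padicValRat p q = 0)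
    (W' : WeierstrassCurve ℚ) (φ : Isogeny (⟨a1, a2, a3, a4, a6⟩ : WeierstrassCurve ℚ) W')
    (ψ : Isogeny W' (⟨a1, a2, a3, a4, a6⟩ : WeierstrassCurve ℚ))
    (hψφ : ∀ P : (⟨a1, a2, a3, a4, a6⟩ : WeierstrassCurve ℚ).geomPoints, ψ (φ P) = (p : ℤ) • P)
    (hinj : ∀ a, shaMap φ.toAddMonoidHom φ.equivariant φ.hasLocalPointsMaps_toAddMonoidHom a = 0 → a = 0)
    (hker : ∀ a, shaMap ψ.toAddMonoidHom ψ.equivariant ψ.hasLocalPointsMaps_toAddMonoidHom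
        (shaMap φ.toAddMonoidHom φ.equivariant φ.hasLocalPointsMaps_toAddMonoidHom a) = 0 →
      shaMap φ.toAddMonoidHom φ.equivariant φ.hasLocalPointsMaps_toAddMonoidHom a = 0) :
    BSDp (⟨a1, a2, a3, a4, a6⟩ : WeierstrassCurve ℚ) p :=
  bsdp_of_ainvs_of_shaMap_injective_of_ker_inter_range hGZK a1 a2 a3 a4 a6 p hΔ (by omega) hq hv
    W' φ ψ hψφ hinj hker

end Summit.BirchSwinnertonDyer.Rank1Residual.LW16

end
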